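import Summits.AtomisticToContinuum.HydrodynamicLimit.Theorems.RelayRaceLocalityNearConstantShortTimeHLFlowFubini
import HarnessLib

/-!
# Crux `NearConstantShortTimeHL` (stmt-AtomisticToContinuum-12502), line `small-tilt-domination` (v18):
# Markov bound for the integrated fourth velocity moment along the true law

Support file for the crux `…Theses.RelayRaceLocality.NearConstantShortTimeHL`, line `small-tilt-domination`,
registered stub **`intFourthMoment_markov`**.

For a hard-sphere flow `Φ` on `𝕋³`, a finite law `P ≪ Liouville` with Gaussian velocity tails in mean on `[0, t]`,
`E_P n⁻¹ Σᵢ exp (a ‖vᵢ(s)‖²) ≤ A` for `s ∈ [0, t]` (`0 < a`), the INTEGRATED fourth-moment cap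
`∫₀ᵗ n⁻¹ Σᵢ ‖vᵢ(r)‖⁴ dr ≤ K` fails with probability at most `2 t A / (a² K)`:

* pointwise `x⁴ ≤ (2/a²) exp (a x²)` (`y²/2 ≤ exp y` for `y = a x² ≥ 0`), hence
  `n⁻¹ Σᵢ ‖vᵢ‖⁴ ≤ (2/a²) n⁻¹ Σᵢ exp (a ‖vᵢ‖²)` for every configuration;
* replace the flow by its jointly measurable version (`xb_exists_measurable_flow`), which changes nothing on good,
  i.e. `P`-almost all, initial data;
* Markov's inequality for `z ↦ ∫₀ᵗ n⁻¹ Σᵢ ‖vᵢ(r)‖⁴ dr` and Tonelli (`lintegral_lintegral_swap`) to evaluate its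
  mean as `∫₀ᵗ E_P n⁻¹ Σᵢ ‖vᵢ(r)‖⁴ dr ≤ t · (2/a²) A`.

No definitions, no named facts. References: H.-T. Yau, Lett. Math. Phys. 22 (1991) §2 (the relative-entropy method;
this is one of its bookkeeping facts); R. K. Alexander, PhD thesis (1975) Ch. 2 (measurability of the flow).
-/

noncomputable section

namespace Summit.AtomisticToContinuum.HydrodynamicLimit.Theorems.NearConstantShortTimeHL

open scoped BigOperators ENNReal
open MeasureTheory Set Filter
open Literature.MathematicalPhysics.KineticTheory Literature.Analysis.FluidPDE Literature.Analysis.FunctionSpaces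

/-! ## The pointwise bound `x⁴ ≤ (2/a²) exp (a x²)` -/

/-- For `0 < a` and real `x`: `x⁴ ≤ (2/a²) exp (a x²)` (from `1 + y + y²/2 ≤ exp y`, `y = a x² ≥ 0`). [folklore] -/
theorem ym_pow_four_le_exp {a : ℝ} (ha : 0 < a) (x : ℝ) : x ^ 4 ≤ 2 / a ^ 2 * Real.exp (a * x ^ 2) := by
  have hy : 0 ≤ a * x ^ 2 := mul_nonneg ha.le (sq_nonneg x)
  have h := Real.quadratic_le_exp_of_nonneg hy
  have hsq : (a * x ^ 2) ^ 2 = x ^ 4 * a ^ 2 := by ring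
  rw [div_mul_eq_mul_div, le_div_iff₀ (pow_pos ha 2)]
  nlinarith [h, hy, hsq]

/-- The fourth velocity moment per particle is dominated by the Gaussian moment per particle:
`n⁻¹ Σᵢ ‖vᵢ‖⁴ ≤ (2/a²) · n⁻¹ Σᵢ exp (a ‖vᵢ‖²)` (`0 < a`). [folklore] -/
theorem ym_fourthMoment_le_expMoment {n : ℕ} {a : ℝ} (ha : 0 < a) (w : Config n (Fin 3) T3) :
    (n : ℝ)⁻¹ * ∑ i : Fin n, ‖(w i).2‖ ^ 4 ≤
      2 / a ^ 2 * ((n : ℝ)⁻¹ * ∑ i : Fin n, Real.exp (a * ‖(w i).2‖ ^ 2)) := by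
  calc (n : ℝ)⁻¹ * ∑ i : Fin n, ‖(w i).2‖ ^ 4
      ≤ (n : ℝ)⁻¹ * ∑ i : Fin n, 2 / a ^ 2 * Real.exp (a * ‖(w i).2‖ ^ 2) :=
        mul_le_mul_of_nonneg_left (Finset.sum_le_sum fun i _ => ym_pow_four_le_exp ha ‖(w i).2‖)
          (inv_nonneg.2 (Nat.cast_nonneg n))
    _ = 2 / a ^ 2 * ((n : ℝ)⁻¹ * ∑ i : Fin n, Real.exp (a * ‖(w i).2‖ ^ 2)) := by
        rw [← Finset.mul_sum]
        ring

/-- The same domination in `ℝ≥0∞`: `ofReal (n⁻¹ Σᵢ ‖vᵢ‖⁴) ≤ ofReal (2/a²) * ofReal (n⁻¹ Σᵢ exp (a ‖vᵢ‖²))`. [folklore] -/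
theorem ym_ofReal_fourthMoment_le {n : ℕ} {a : ℝ} (ha : 0 < a) (w : Config n (Fin 3) T3) :
    ENNReal.ofReal ((n : ℝ)⁻¹ * ∑ i : Fin n, ‖(w i).2‖ ^ 4) ≤
      ENNReal.ofReal (2 / a ^ 2) * ENNReal.ofReal ((n : ℝ)⁻¹ * ∑ i : Fin n, Real.exp (a * ‖(w i).2‖ ^ 2)) := by
  rw [← ENNReal.ofReal_mul (by positivity)]
  exact ENNReal.ofReal_le_ofReal (ym_fourthMoment_le_expMoment ha w)

/-- The fourth velocity moment per particle `n⁻¹ Σᵢ ‖vᵢ‖⁴` is a measurable function of the configuration (a finite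
sum of continuous functions of one velocity coordinate). [folklore] -/
theorem ym_measurable_fourthMoment {n : ℕ} :
    Measurable fun w : Config n (Fin 3) T3 => (n : ℝ)⁻¹ * ∑ i : Fin n, ‖(w i).2‖ ^ 4 := by
  have hv : ∀ i : Fin n, Measurable fun w : Config n (Fin 3) T3 => (w i).2 := fun i =>
    (measurable_pi_apply i).snd
  exact (Finset.measurable_sum _ fun i _ => ((hv i).norm.pow_const 4)).const_mul _

/-! ## Markov and Tonelli for a time-integrated observable -/

/-- **Markov–Tonelli for a time integral.** For a finite measure `P`, a jointly measurable `G : ℝ × Ω → ℝ≥0∞` with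
slice means `∫⁻ G (r, ·) dP ≤ B` for `r ∈ [0, t]`, and a level `0 < k < ∞`:
`P {k ≤ ∫_{[0,t]} G (r, ·) dr} ≤ B · t / k` (Markov's inequality, then Tonelli `lintegral_lintegral_swap`).
[folklore] -/
theorem ym_meas_ge_timeIntegral_le {Ω : Type*} [MeasurableSpace Ω] (P : Measure Ω) [IsFiniteMeasure P]
    {G : ℝ × Ω → ℝ≥0∞} (hG : Measurable G) (t : ℝ) {B : ℝ≥0∞} (hB : ∀ r ∈ Icc 0 t, ∫⁻ z, G (r, z) ∂P ≤ B)
    {k : ℝ≥0∞} (hk : k ≠ 0) (hk' : k ≠ ∞) :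
    P {z | k ≤ ∫⁻ r in Icc 0 t, G (r, z)} ≤ B * ENNReal.ofReal t / k := by
  have hGs : Measurable fun p : Ω × ℝ => G (p.2, p.1) := hG.comp measurable_swap
  have hYm : Measurable fun z => ∫⁻ r in Icc 0 t, G (r, z) :=
    hGs.lintegral_prod_right' (ν := volume.restrict (Icc 0 t))
  refine (meas_ge_le_lintegral_div hYm.aemeasurable hk hk').trans (ENNReal.div_le_div_right ?_ k)
  calc ∫⁻ z, (∫⁻ r in Icc 0 t, G (r, z)) ∂P
      = ∫⁻ r in Icc 0 t, ∫⁻ z, G (r, z) ∂P := lintegral_lintegral_swap hGs.aemeasurable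
    _ ≤ ∫⁻ _ in Icc 0 t, B := setLIntegral_mono measurable_const fun r hr => hB r hr
    _ = B * ENNReal.ofReal t := by rw [setLIntegral_const, Real.volume_Icc, sub_zero]

/-! ## The registered stub -/

/-- **Registered stub `intFourthMoment_markov`.** For a hard-sphere flow `Φ` on `𝕋³` and a finite law `P ≪ Liouville`
with Gaussian velocity tails in mean on `[0, t]`, `E_P n⁻¹ Σᵢ exp (a ‖vᵢ(s)‖²) ≤ A` (`s ∈ [0, t]`, `0 < a`), the
integrated fourth-moment cap fails with small probability:
`P {K < ∫₀ᵗ n⁻¹ Σᵢ ‖vᵢ(r)‖⁴ dr} ≤ 2 t A / (a² K)` for every `K > 0`. Proof: `x⁴ ≤ (2/a²) exp (a x²)` pointwise;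
the flow is replaced by its jointly measurable version (`xb_exists_measurable_flow`) off a `P`-null set; Markov's
inequality and Tonelli along `[0, t] × Config` (`ym_meas_ge_timeIntegral_le`). [folklore] -/
theorem intFourthMoment_markov : ∀ {ε : ℝ} {n : ℕ} (Φ : HardSphereFlow (Torus.geometry (Fin 3)) ε n) (P : Measure (Config n (Fin 3) T3)) [IsFiniteMeasure P], P ≪ liouville (Torus.geometry (Fin 3)) n ε → ∀ {a A t : ℝ}, 0 < a → 0 ≤ A → 0 ≤ t → (∀ s ∈ Set.Icc 0 t, ∫⁻ z, ENNReal.ofReal ((n : ℝ)⁻¹ * ∑ i : Fin n, Real.exp (a * ‖((Φ.flow s z) i).2‖ ^ 2)) ∂P ≤ ENNReal.ofReal A) → ∀ K : ℝ, 0 < K → P {z | ENNReal.ofReal K < ∫⁻ r in Set.Icc 0 t, ENNReal.ofReal ((n : ℝ)⁻¹ * ∑ i : Fin n, ‖((Φ.flow r z) i).2‖ ^ 4)} ≤ ENNReal.ofReal (2 * t * A / a ^ 2 / K) := by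
  intro ε n Φ P _ hP a A t ha hA _ hexp K hK
  obtain ⟨F, hFm, hF⟩ := xb_exists_measurable_flow Φ
  have hgood : ∀ᵐ z ∂P, z ∈ Φ.good := hP.ae_le Φ.ae_mem_good
  -- the jointly measurable integrand (flow replaced by its measurable version)
  have hGm : Measurable fun p : ℝ × Config n (Fin 3) T3 =>
      ENNReal.ofReal ((n : ℝ)⁻¹ * ∑ i : Fin n, ‖((F p) i).2‖ ^ 4) :=
    (ym_measurable_fourthMoment.comp hFm).ennreal_ofReal
  -- the slice means are bounded by `(2/a²) A` on `[0, t]`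
  have hB : ∀ r ∈ Icc 0 t,
      ∫⁻ z, ENNReal.ofReal ((n : ℝ)⁻¹ * ∑ i : Fin n, ‖((F (r, z)) i).2‖ ^ 4) ∂P ≤
        ENNReal.ofReal (2 / a ^ 2) * ENNReal.ofReal A := by
    intro r hr
    calc ∫⁻ z, ENNReal.ofReal ((n : ℝ)⁻¹ * ∑ i : Fin n, ‖((F (r, z)) i).2‖ ^ 4) ∂P
        = ∫⁻ z, ENNReal.ofReal ((n : ℝ)⁻¹ * ∑ i : Fin n, ‖((Φ.flow r z) i).2‖ ^ 4) ∂P := by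
          refine lintegral_congr_ae ?_
          filter_upwards [hgood] with z hz
          rw [hF r z hz]
      _ ≤ ∫⁻ z, ENNReal.ofReal (2 / a ^ 2) *
            ENNReal.ofReal ((n : ℝ)⁻¹ * ∑ i : Fin n, Real.exp (a * ‖((Φ.flow r z) i).2‖ ^ 2)) ∂P :=
          lintegral_mono fun z => ym_ofReal_fourthMoment_le ha (Φ.flow r z)
      _ = ENNReal.ofReal (2 / a ^ 2) *
            ∫⁻ z, ENNReal.ofReal ((n : ℝ)⁻¹ * ∑ i : Fin n, Real.exp (a * ‖((Φ.flow r z) i).2‖ ^ 2)) ∂P :=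
          lintegral_const_mul' _ _ ENNReal.ofReal_ne_top
      _ ≤ ENNReal.ofReal (2 / a ^ 2) * ENNReal.ofReal A := by
          gcongr
          exact hexp r hr
  -- Markov and Tonelli for the measurable version
  have hmain : P {z | ENNReal.ofReal K ≤
      ∫⁻ r in Icc 0 t, ENNReal.ofReal ((n : ℝ)⁻¹ * ∑ i : Fin n, ‖((F (r, z)) i).2‖ ^ 4)} ≤
        ENNReal.ofReal (2 / a ^ 2) * ENNReal.ofReal A * ENNReal.ofReal t / ENNReal.ofReal K :=
    ym_meas_ge_timeIntegral_le P hGm t hB (ENNReal.ofReal_pos.2 hK).ne' ENNReal.ofReal_ne_top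
  -- the constants
  have hconst : ENNReal.ofReal (2 / a ^ 2) * ENNReal.ofReal A * ENNReal.ofReal t / ENNReal.ofReal K =
      ENNReal.ofReal (2 * t * A / a ^ 2 / K) := by
    rw [← ENNReal.ofReal_mul (by positivity : (0 : ℝ) ≤ 2 / a ^ 2),
      ← ENNReal.ofReal_mul (mul_nonneg (by positivity : (0 : ℝ) ≤ 2 / a ^ 2) hA),
      ENNReal.ofReal_div_of_pos hK]
    congr 2
    ring
  -- the event along the flow is a.e. contained in the event for the measurable version
  calc P {z | ENNReal.ofReal K <
          ∫⁻ r in Icc 0 t, ENNReal.ofReal ((n : ℝ)⁻¹ * ∑ i : Fin n, ‖((Φ.flow r z) i).2‖ ^ 4)}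
      ≤ P {z | ENNReal.ofReal K ≤
          ∫⁻ r in Icc 0 t, ENNReal.ofReal ((n : ℝ)⁻¹ * ∑ i : Fin n, ‖((F (r, z)) i).2‖ ^ 4)} := by
        refine measure_mono_ae ?_
        filter_upwards [hgood] with z hz h
        change ENNReal.ofReal K ≤ _
        replace h : ENNReal.ofReal K <
            ∫⁻ r in Icc 0 t, ENNReal.ofReal ((n : ℝ)⁻¹ * ∑ i : Fin n, ‖((Φ.flow r z) i).2‖ ^ 4) := h
        refine h.le.trans (le_of_eq (lintegral_congr fun r => ?_))
        rw [hF r z hz]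
    _ ≤ ENNReal.ofReal (2 / a ^ 2) * ENNReal.ofReal A * ENNReal.ofReal t / ENNReal.ofReal K := hmain
    _ = ENNReal.ofReal (2 * t * A / a ^ 2 / K) := hconst

end Summit.AtomisticToContinuum.HydrodynamicLimit.Theorems.NearConstantShortTimeHL

end
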